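import Mathlib
import HarnessLib
import Summits.Ventures.LatticeQCDFlow.Exactness.SphereLuscherSeriesSolver
import Summits.Ventures.LatticeQCDFlow.Exactness.SphereLuscherSeriesLocalityES

/-!
# The universal solver reproduces Engel–Schaefer's eq. (15) on the nose: `T⁽⁰⁾ = q₂(𝔏) S = S/(2(d−1)) − S₀/(2(d−1))` as functions on `E^Λ`

HONEST FRAMING: exact (Metropolis-corrected) sampling algorithms for lattice gauge theory;
figures of merit are autocorrelation/cost numbers at stated couplings and volumes; no
continuum-physics claim.

Venture `LatticeQCDFlow` (cell pub-lqcd), topic `Exactness`; FANOUT row 7 (`s0-cpn-null`: the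
S0-D1 rung — 2D CP⁹, Lüscher's LO trivializing map inside HMC, Engel–Schaefer 2011).  NEW WORK of
the cell over the tree's `Exactness/SphereLuscherSeriesSolver.lean` (`solverPoly`, `solverTerm`,
`labelSet`), `Exactness/SphereLatticeLaplacianSpectrum.lean` (eigenvalues of `polyLap` are labels),
`Exactness/LatticeSitePolynomialOperator.lean` (`polyLap`, `ambSiteLap`),
`Exactness/SphereLuscherSeriesLocalityES.lean` (`siteDeriv_esAction`, `siteEuler_esAction`,
supports of `⟪J_k, ·⟫`), `Exactness/LatticeSiteLocality.lean` and `Exactness/SphereLOFlowAction.lean`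
(`esAction`, `loFlowAction`); nothing is cited as a fact.  Printed counterpart, NAMED ONLY:
Engel–Schaefer, Comput. Phys. Commun. 182 (2011) 2107, §3 eq. (15) (`S̃⁽⁰⁾ = S/(2(2N−1))`);
M. Lüscher, Commun. Math. Phys. 293 (2010) 899, §4.3 eq. (4.12).

## Content (`E` finite-dimensional, `d = dim E ≥ 2`; couplings `U` with no self-coupling and adjoint
## pairs; `S = esAction κ S₀ U`)

* `siteFlatLap_esAction` (`= 0`: `J_k` does not involve `x_k`), **`ambSiteLap_esAction`**
  (`ambSiteLap k S = 2κ(d−1)⟪J_k, x_k⟫`), **`polyLap_esAction_sub_const`** — AS AMBIENT FUNCTIONS,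
  `𝔏 (S − S₀) = 2(d−1)·(S − S₀)`: `S − S₀` is an eigenvector of `polyLap 2` with the label `2(d−1)`
  of the two-site monomials (no restriction to the spheres needed).
* `aeval_polyLap_esAction_sub_const` (`p(𝔏)(S − S₀) = p(2(d−1))·(S − S₀)`),
  `eval_solverPoly_two_mul` (`q₂(2(d−1)) = 1/(2(d−1))` as soon as `S ≠ S₀`).
* **`solverTerm_zero_esAction`** — THE CHECK: the order-`0` term of the explicit series of
  `SphereLuscherSeriesSolver` for the Engel–Schaefer action IS `S/(2(d−1)) − S₀/(2(d−1))`, i.e.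
  `loFlowAction κ S₀ U − S₀/(2(d−1))`, identically on `E^Λ` (not only on the spheres, not only up to
  a constant); **`solverTerm_zero_esAction_sphere`** — on `Ω` it differs from E–S's `S̃⁽⁰⁾` by the
  constant `−S₀/(2(d−1))`.

NOT CLAIMED: the analogous on-the-nose identity at order `1` (there the solver's ambient output and
the closed form `nloFlowAction` need only agree on the spheres up to constants, which the tree
already has: `luscher_series_eq_solverTerm` with `nloFlowAction_unique`); anything quantitative.
-/

noncomputable section

namespace Summit.Ventures.LatticeQCDFlow.Exactness

open Function Set Metric Polynomial
open scoped RealInnerProductSpace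

variable {Λ : Type*} {E : Type*} [NormedAddCommGroup E] [InnerProductSpace ℝ E]
  [FiniteDimensional ℝ E]
variable [Fintype Λ] [DecidableEq Λ] {U : Λ → Λ → (E →L[ℝ] E)}

/-! ## §1 `𝔏 (S − S₀) = 2(d−1)(S − S₀)` as ambient functions -/

section Eigen

omit [FiniteDimensional ℝ E] in
/-- With no self-coupling, `x ↦ ⟪J_k x, v⟫` does not depend on `x_k`: its site-`k` derivative
vanishes. -/
theorem siteDeriv_inner_localField_eq_zero (hU0 : ∀ n, U n n = 0) (k : Λ) (v w : E) :
    siteDeriv k w (fun x => ⟪localField U k x, v⟫) = 0 := by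
  refine siteDeriv_eq_zero_of_not_mem (inner_localField_mem_sdepOn (U := U) subset_rfl v) ?_ w
  simp [couplingNbhd, hU0 k]

/-- **The flat site Laplacian of the E–S action vanishes**: `Σ_i D_{k,b_i} D_{k,b_i} S = 0`
(`D_k S · v = −2κ⟪J_k, v⟫` is constant in `x_k`). -/
theorem siteFlatLap_esAction (hU0 : ∀ n, U n n = 0)
    (hUadj : ∀ m n (v w : E), ⟪U m n v, w⟫ = ⟪v, U n m w⟫) (κ S₀ : ℝ) (k : Λ) (x : Λ → E) :
    siteFlatLap k (esAction κ S₀ U) x = 0 := by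
  unfold siteFlatLap
  refine Finset.sum_eq_zero fun i _ => ?_
  rw [siteDeriv_esAction hU0 hUadj κ S₀ k]
  have e : (fun x => -(2 * κ) * ⟪localField U k x, stdOrthonormalBasis ℝ E i⟫) =
      (-(2 * κ)) • fun x => ⟪localField U k x, stdOrthonormalBasis ℝ E i⟫ := by
    funext y; simp
  rw [e, siteDeriv_smul_of_contDiff ((contDiff_localField U k).inner ℝ contDiff_const),
    siteDeriv_inner_localField_eq_zero hU0]
  simp

omit [FiniteDimensional ℝ E] in
/-- **Euler twice on the E–S action**: `E_k (E_k S) = E_k S` (the site section is affine). -/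
theorem siteEuler_siteEuler_esAction (hU0 : ∀ n, U n n = 0)
    (hUadj : ∀ m n (v w : E), ⟪U m n v, w⟫ = ⟪v, U n m w⟫) (κ S₀ : ℝ) (k : Λ) (x : Λ → E) :
    siteEuler k (siteEuler k (esAction κ S₀ U)) x = siteEuler k (esAction κ S₀ U) x := by
  rw [siteEuler_esAction hU0 hUadj κ S₀ k]
  -- the section `y ↦ −2κ ⟪J_k, y⟫` (with `J_k` frozen) is linear in `y`
  simp only [siteEuler, siteDeriv]
  have hJ : ∀ y : E, localField U k (update x k y) = localField U k x := fun y => by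
    refine localField_congr (A := couplingNbhd U k) subset_rfl fun m hm => ?_
    have hmk : m ≠ k := by rintro rfl; simp [couplingNbhd, hU0 m] at hm
    exact update_of_ne hmk _ _
  have e : (fun y => -(2 * κ) * ⟪localField U k (update x k y), update x k y k⟫) =
      fun y => ⟪(-(2 * κ)) • localField U k x, y⟫ + 0 := by
    funext y; rw [hJ y, update_self, real_inner_smul_left, add_zero]
  rw [e, fderiv_inner_add_const]
  simp only [innerSL_apply_apply, real_inner_smul_left]

/-- **The ambient site operator on the E–S action**: `ambSiteLap k S = 2κ(d−1) ⟪J_k, x_k⟫`. -/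
theorem ambSiteLap_esAction (hU0 : ∀ n, U n n = 0)
    (hUadj : ∀ m n (v w : E), ⟪U m n v, w⟫ = ⟪v, U n m w⟫) (κ S₀ : ℝ) (k : Λ) (x : Λ → E) :
    ambSiteLap k (esAction κ S₀ U) x =
      2 * κ * ((Module.finrank ℝ E : ℝ) - 1) * ⟪localField U k x, x k⟫ := by
  rw [ambSiteLap, siteFlatLap_esAction hU0 hUadj, siteEuler_siteEuler_esAction hU0 hUadj,
    siteEuler_esAction hU0 hUadj]
  ring

/-- **`𝔏 S = 2(d−1)(S − S₀)` as ambient functions** (sum over sites of `ambSiteLap_esAction`). -/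
theorem neg_sum_ambSiteLap_esAction (hU0 : ∀ n, U n n = 0)
    (hUadj : ∀ m n (v w : E), ⟪U m n v, w⟫ = ⟪v, U n m w⟫) (κ S₀ : ℝ) (x : Λ → E) :
    -∑ k, ambSiteLap k (esAction κ S₀ U) x =
      2 * ((Module.finrank ℝ E : ℝ) - 1) * (esAction κ S₀ U x - S₀) := by
  simp_rw [ambSiteLap_esAction hU0 hUadj, esAction_sub_const]
  rw [← Finset.mul_sum]
  simp_rw [real_inner_comm (localField U _ x)]
  ring

omit [DecidableEq Λ] in
/-- `S − S₀` as a member of `polyS 2`. -/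
theorem esAction_sub_const_mem_polyS (κ S₀ : ℝ) (U : Λ → Λ → (E →L[ℝ] E)) :
    (fun x => esAction κ S₀ U x - S₀) ∈ polyS Λ E 2 :=
  (polyS Λ E 2).sub_mem (esAction_mem_polyS κ S₀ U) (const_mem_polyS 2 S₀)

/-- **`S − S₀` IS AN EIGENVECTOR OF `polyLap 2` WITH EIGENVALUE `2(d−1)`** (the label of the two-site
monomials `x_{n,i} x_{m,j}`, `n ≠ m`), as ambient functions. -/
theorem polyLap_esAction_sub_const (hU0 : ∀ n, U n n = 0)
    (hUadj : ∀ m n (v w : E), ⟪U m n v, w⟫ = ⟪v, U n m w⟫) (κ S₀ : ℝ) :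
    polyLap Λ E 2 ⟨fun x => esAction κ S₀ U x - S₀, esAction_sub_const_mem_polyS κ S₀ U⟩ =
      (2 * ((Module.finrank ℝ E : ℝ) - 1)) •
        ⟨fun x => esAction κ S₀ U x - S₀, esAction_sub_const_mem_polyS κ S₀ U⟩ := by
  apply Subtype.ext
  funext x
  rw [polyLap_apply, Submodule.coe_smul, Pi.smul_apply, smul_eq_mul]
  have hS := contDiff_of_mem_polyS (esAction_mem_polyS κ S₀ U)
  have e : (fun x => esAction κ S₀ U x - S₀) = esAction κ S₀ U + fun _ => -S₀ := by
    funext y; simp [sub_eq_add_neg]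
  have h : ∀ k, ambSiteLap k (fun x => esAction κ S₀ U x - S₀) x = ambSiteLap k (esAction κ S₀ U) x :=
    fun k => by
      rw [e, ambSiteLap_add hS contDiff_const, Pi.add_apply, ambSiteLap_const, Pi.zero_apply, add_zero]
  simp_rw [h]
  exact neg_sum_ambSiteLap_esAction hU0 hUadj κ S₀ x

/-- **Polynomial calculus**: `p(𝔏)(S − S₀) = p(2(d−1)) • (S − S₀)`. -/
theorem aeval_polyLap_esAction_sub_const (hU0 : ∀ n, U n n = 0)
    (hUadj : ∀ m n (v w : E), ⟪U m n v, w⟫ = ⟪v, U n m w⟫) (κ S₀ : ℝ) (p : ℝ[X]) :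
    aeval (polyLap Λ E 2) p ⟨fun x => esAction κ S₀ U x - S₀, esAction_sub_const_mem_polyS κ S₀ U⟩ =
      p.eval (2 * ((Module.finrank ℝ E : ℝ) - 1)) •
        ⟨fun x => esAction κ S₀ U x - S₀, esAction_sub_const_mem_polyS κ S₀ U⟩ :=
  Module.End.aeval_apply_of_mem_apply_eq_smul (polyLap_esAction_sub_const hU0 hUadj κ S₀)

/-- **`q₂(2(d−1)) · (S − S₀) = (S − S₀)/(2(d−1))`**: either `S = S₀` identically, or `2(d−1)` is an
eigenvalue of `polyLap 2`, hence a label of degree `≤ 2`, on which `q₂` interpolates `λ ↦ λ⁻¹`. -/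
theorem eval_solverPoly_smul_esAction_sub_const (hU0 : ∀ n, U n n = 0)
    (hUadj : ∀ m n (v w : E), ⟪U m n v, w⟫ = ⟪v, U n m w⟫) (κ S₀ : ℝ) :
    (solverPoly Λ E 2).eval (2 * ((Module.finrank ℝ E : ℝ) - 1)) •
        (⟨fun x => esAction κ S₀ U x - S₀, esAction_sub_const_mem_polyS κ S₀ U⟩ : polyS Λ E 2) =
      (2 * ((Module.finrank ℝ E : ℝ) - 1))⁻¹ •
        ⟨fun x => esAction κ S₀ U x - S₀, esAction_sub_const_mem_polyS κ S₀ U⟩ := by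
  by_cases h0 : (⟨fun x => esAction κ S₀ U x - S₀, esAction_sub_const_mem_polyS κ S₀ U⟩ :
      polyS Λ E 2) = 0
  · rw [h0, smul_zero, smul_zero]
  · have hev : Module.End.HasEigenvalue (polyLap Λ E 2) (2 * ((Module.finrank ℝ E : ℝ) - 1)) :=
      Module.End.hasEigenvalue_of_hasEigenvector
        ⟨Module.End.mem_eigenspace_iff.2 (polyLap_esAction_sub_const hU0 hUadj κ S₀), h0⟩
    have hmem : 2 * ((Module.finrank ℝ E : ℝ) - 1) ∈ labelSet Λ E 2 :=
      mem_labelSet.2 (exists_eigLabel_of_hasEigenvalue hev)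
    rw [eval_solverPoly hmem]

end Eigen

/-! ## §2 Order zero of the explicit series is Engel–Schaefer's `S/(2(d−1))`, on the nose -/

section OrderZero

/-- **THE CHECK.**  For the Engel–Schaefer action (no self-coupling, adjoint pairs), the order-`0`
term of the explicit Lüscher series of `SphereLuscherSeriesSolver` is, identically on `E^Λ`,
`T⁽⁰⁾ = q₂(𝔏) S = (S − S₀)/(2(d−1)) = loFlowAction κ S₀ U − S₀/(2(d−1))` — Engel–Schaefer's eq. (15)
up to its (irrelevant) additive constant. -/
theorem solverTerm_zero_esAction (hU0 : ∀ n, U n n = 0)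
    (hUadj : ∀ m n (v w : E), ⟪U m n v, w⟫ = ⟪v, U n m w⟫) (κ S₀ : ℝ) (x : Λ → E) :
    solverTerm (esAction_mem_polyS κ S₀ U) 0 x =
      loFlowAction κ S₀ U x - (2 * ((Module.finrank ℝ E : ℝ) - 1))⁻¹ * S₀ := by
  -- split `S = (S − S₀) + S₀` inside `polyS 2`
  have hsplit : (⟨esAction κ S₀ U, esAction_mem_polyS κ S₀ U⟩ : polyS Λ E 2) =
      ⟨fun x => esAction κ S₀ U x - S₀, esAction_sub_const_mem_polyS κ S₀ U⟩ +
        ⟨fun _ => S₀, const_mem_polyS 2 S₀⟩ := by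
    apply Subtype.ext; funext y; simp
  have hconst : aeval (polyLap Λ E 2) (solverPoly Λ E 2) (⟨fun _ => S₀, const_mem_polyS 2 S₀⟩ :
      polyS Λ E 2) = 0 := by
    rw [Module.End.aeval_apply_of_mem_apply_eq_smul (μ := 0)
      (by rw [polyLap_const, zero_smul]), eval_solverPoly (zero_mem_labelSet 2), inv_zero, zero_smul]
  show ((aeval (polyLap Λ E 2) (solverPoly Λ E 2)
    ⟨esAction κ S₀ U, esAction_mem_polyS κ S₀ U⟩ : polyS Λ E 2) : (Λ → E) → ℝ) x = _
  rw [hsplit, map_add, hconst, add_zero, aeval_polyLap_esAction_sub_const hU0 hUadj,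
    eval_solverPoly_smul_esAction_sub_const hU0 hUadj, Submodule.coe_smul, Pi.smul_apply, smul_eq_mul,
    loFlowAction]
  ring

/-- **On the product of unit spheres**, the explicit order-`0` term differs from E–S's
`S̃⁽⁰⁾ = loFlowAction` by the constant `−S₀/(2(d−1))`. -/
theorem solverTerm_zero_esAction_sphere (hU0 : ∀ n, U n n = 0)
    (hUadj : ∀ m n (v w : E), ⟪U m n v, w⟫ = ⟪v, U n m w⟫) (κ S₀ : ℝ) (ξ : Λ → sphere (0 : E) 1) :
    solverTerm (esAction_mem_polyS κ S₀ U) 0 (fun n => (ξ n : E)) -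
        loFlowAction κ S₀ U (fun n => (ξ n : E)) =
      -((2 * ((Module.finrank ℝ E : ℝ) - 1))⁻¹ * S₀) := by
  rw [solverTerm_zero_esAction hU0 hUadj]
  ring

end OrderZero

end Summit.Ventures.LatticeQCDFlow.Exactness

end
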